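import Mathlib
import Literature.Analysis.FluidPDE.TypeIICoreWitness
import Literature.Analysis.FluidPDE.SuitableWeak
import Literature.Analysis.FluidPDE.NSWave0
import Summits.NavierStokesRegularity.NavierStokesRegularity.Theorems.TypeIIInviscidRelaxationCoreExclusionAnchorObstructionFloor
import HarnessLib

/-!
# Crux `ColumnarCoreExclusion` (stmt-1966): the anchor stub's residual survives the ENERGY CLASS —
# columnar core witnesses at every level carry no energy (a thin-tube family)

`--supports stmt-NavierStokesRegularity-1966` (helper file, negative side; theorems only, no definitions, no `sorry`;
outside the import cone of the route file).

The registered anchor stub `stub_anchoredLateColumnarWitness` (line `columnar_comparison_flow`, skeleton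
`812bbbce6ea9853a`) asks, beyond the crux hypothesis `hw` ("level-`K` columnar core witnesses at every level `K > 0`
frequently before `T`"), for witnesses that are LATE (`(T - t)·V ≤ K·L`) and have, in effect, a core-radius floor
(`CoreExclusionAnchor.anchoredLateWitness_of_lateWitnesses_radiusFloor`, p831087).  The obstruction series
`…CoreExclusionAnchorObstruction{,Floor,Late,Wandering}` (p832090, p832161, p832578, p832667) certified with explicit
KINEMATIC families that lateness, the floor and anchoring are not consequences of `hw` and the blow-up rate.  No
certificate of that series records an energy bound, and the never-late / floor-less corner (p832090: cone core of
radius `(1-t)²`, speed `(1-t)⁻³`, length `(1-t)/3`) has UNBOUNDED kinetic energy `≍ (1-t)⁻¹` as `t ↑ 1`; so it was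
left open whether the one slice-wise constraint that the stub's Leray–Hopf hypothesis does supply — a uniform bound on
`∫ ‖u(t)‖²` — could interact with `hw` (a refuter note on the item suggested that a level-`K` columnar witness forces
`∫_{B(x₀,KL)} ‖u‖² ≳ V²L³K³`).

THIS FILE CLOSES THAT DOOR.  The witness clauses of `TypeIICoreWitness` do not bound the THICKNESS of the core (the
profile `W` is arbitrary and the closeness is `C⁰`), so a columnar core may be a needle:

* `exists_columnarWitnesses_never_late_boundedEnergy` — the thin-tube family `u(t,x) = s⁻³·max(0, 1 - r(x)/s⁴)·e_z`
  cut off outside `‖x‖ ≤ s/3`, `s = 1 - t` (NOT a Navier–Stokes solution) satisfies: (i) `hw` verbatim at viscosity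
  `1`, `T = 1` (level-`K` columnar witnesses at every level frequently before `1`); (ii) `¬ IsTypeIBlowup u 1`;
  (iii) `HasBoundedEnergy u`; (iv) indeed VANISHING energy, `∫ ‖u(t)‖² ≤ (8/3)(1-t)³`; (v) support shrinking to the
  origin, `u(t,x) ≠ 0 → ‖x‖ ≤ (1-t)/3` (so every far-field bound holds trivially); and yet (vi) at every time
  `0 < t < 1` EVERY level-`K` datum (`K > 4`) satisfying the speed-bound, near-maximum and columnar-closeness clauses
  has core radius `K·L ≤ 1 - t` (no floor) and `K·L < (1 - t)·V` (not late); (vii) in particular no late level-`5`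
  witness exists at any time in `(0, 1)`.
* `exists_columnarWitness_energy_le` — COROLLARY: for every level `K > 0` and every `ε > 0` there is a slice carrying
  a level-`K` columnar core witness (viscosity `1`) with kinetic energy `≤ ε`.  So no energy lower bound follows from a
  witness at any level: the "energy sanity" heuristic is not a property of the typed witness predicate.

Consequence for the line (honest reading, fifth certificate of the independence series): among the hypotheses of the
anchor stub, everything that can be checked on time slices without the equation — `hw`, the non-Type-I rate, the
energy bound, spatial localisation — is satisfied by a never-late, floor-less family; lateness and the floor must come
from the Navier–Stokes DYNAMICS (local regularity / the geometry of the singular set).  Nothing about Navier–Stokes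
regularity is claimed; no stub or crux is proved or refuted here (the family is not a solution).  decomp-ns leaf hand
6-g28.
-/

noncomputable section

open Set Metric MeasureTheory Filter Topology
open Literature.Analysis.FluidPDE
open scoped ENNReal

namespace Summit.NavierStokesRegularity.NavierStokesRegularity.Theorems

-- the problem directory repeats the summit name (`NavierStokesRegularity/NavierStokesRegularity`)
set_option linter.dupNamespace false

namespace CoreExclusionAnchorObstructionEnergy

open CoreExclusionAnchorObstruction CoreExclusionAnchorObstructionFloor

/-! ### §1 The box volume -/

/-- The axial unit vector has norm one: `‖e_z‖ = 1` (file-local copy). [folklore] -/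
private theorem norm_eZ : ‖(eZ : EuclideanSpace ℝ (Fin 3))‖ = 1 := by
  simp [eZ]

/-- **Volume of a coordinate box in `ℝ³`.**  For `c : Fin 3 → ℝ`, the box `{x | -c i ≤ x i ≤ c i}` (the preimage
of `Icc (-c) c` under the coordinate map) has Lebesgue measure `∏ᵢ (2 cᵢ)` (as `ofReal`; empty factors give `0`).
[folklore] -/
theorem volume_coordBox (c : Fin 3 → ℝ) :
    volume ((WithLp.ofLp : EuclideanSpace ℝ (Fin 3) → (Fin 3 → ℝ)) ⁻¹' Icc (-c) c) =
      ENNReal.ofReal (c 0 + c 0) * ENNReal.ofReal (c 1 + c 1) * ENNReal.ofReal (c 2 + c 2) := by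
  rw [(PiLp.volume_preserving_ofLp (Fin 3)).measure_preimage measurableSet_Icc.nullMeasurableSet,
    Real.volume_Icc_pi, Fin.prod_univ_three]
  simp only [Pi.neg_apply, sub_neg_eq_add]

/-! ### §2 The thin-tube family -/

/-- **Columnar witnesses at every level carry no energy, and the energy class does not force lateness**
(kinematic obstruction for the anchor stub of crux `ColumnarCoreExclusion`, energy-class version).  There is an
explicit family `u : ℝ → ℝ³ → ℝ³` — at time `t < 1`, with `s = 1 - t`: the thin columnar cone core
`s⁻³ · max(0, 1 - r(x)/s⁴) e_z` (tube radius `s⁴`) cut off outside the ball `‖x‖ ≤ s/3` (NOT a Navier–Stokes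
solution) — such that
(i) `u` carries level-`K` COLUMNAR core witnesses at viscosity `1` at every level `K > 0` frequently before `T = 1`
(the crux hypothesis `hw` verbatim: centre `0`, core length `L = K s³`, speed `V = s⁻³`, profile
`y ↦ max(0, 1 - (K/s)·r(y)) e_z`, exact closeness);
(ii) `u` grows faster than the Type-I rate, `¬ IsTypeIBlowup u 1` (`‖u(t,0)‖ = (1-t)⁻³`);
(iii) `u` has BOUNDED ENERGY (`HasBoundedEnergy u`), indeed
(iv) VANISHING energy: `∫ ‖u(t,x)‖² dx ≤ (8/3)(1-t)³` for `t < 1` (speed² `s⁻⁶` times the volume `(8/3)s⁹` of the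
box `[-s⁴,s⁴]² × [-s/3,s/3]` containing the support);
(v) support shrinking to the origin: `u(t,x) ≠ 0 → ‖x‖ ≤ (1-t)/3`;
(vi) for every `K > 4` and every time `0 < t < 1`, EVERY datum `(x₀, L, V, Q, W)` satisfying the speed-bound,
near-maximum and level-`K` columnar-closeness clauses has core radius `K·L ≤ 1 - t` (no floor) and
`K·L < (1 - t)·V` (not late) (`coreRadius_lt_of_support`);
(vii) consequently no late level-`5` witness exists at any time in `(0,1)`.
So the residual of the registered anchor stub (lateness and a core-radius floor) is not a consequence of `hw`, the
rate, the energy bound and spatial localisation together. [folklore] -/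
theorem exists_columnarWitnesses_never_late_boundedEnergy :
    ∃ u : ℝ → EuclideanSpace ℝ (Fin 3) → EuclideanSpace ℝ (Fin 3),
      (∀ K : ℝ, 0 < K → ∀ t₀ < (1 : ℝ), ∃ t, t₀ < t ∧ t < 1 ∧ TypeIICoreWitness IsColumnar 1 K u t) ∧
      ¬ IsTypeIBlowup u 1 ∧
      HasBoundedEnergy u ∧
      (∀ t < (1 : ℝ), ∫⁻ x, ‖u t x‖ₑ ^ 2 ≤ ENNReal.ofReal (8 / 3 * (1 - t) ^ 3)) ∧
      (∀ (t : ℝ) (x : EuclideanSpace ℝ (Fin 3)), u t x ≠ 0 → ‖x‖ ≤ (1 - t) / 3) ∧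
      (∀ (K t : ℝ), 4 < K → 0 < t → t < 1 →
        ∀ (x₀ : EuclideanSpace ℝ (Fin 3)) (L V : ℝ)
          (Q : EuclideanSpace ℝ (Fin 3) ≃ₗᵢ[ℝ] EuclideanSpace ℝ (Fin 3))
          (W : EuclideanSpace ℝ (Fin 3) → EuclideanSpace ℝ (Fin 3)),
          0 < L → 0 < V → IsColumnar W → (∀ x, ‖u t x‖ ≤ V) →
          (∃ x₁, dist x₁ x₀ ≤ L ∧ V ≤ 2 * ‖u t x₁‖) →
          (∀ y : EuclideanSpace ℝ (Fin 3), ‖y‖ ≤ K →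
            ‖V⁻¹ • Q.symm (u t (x₀ + L • Q y)) - W y‖ ≤ K⁻¹) →
          K * L ≤ 1 - t ∧ K * L < (1 - t) * V) ∧
      ¬ (∃ t : ℝ, 0 < t ∧ t < 1 ∧
        ∃ (x₀ : EuclideanSpace ℝ (Fin 3)) (L V : ℝ)
          (Q : EuclideanSpace ℝ (Fin 3) ≃ₗᵢ[ℝ] EuclideanSpace ℝ (Fin 3))
          (W : EuclideanSpace ℝ (Fin 3) → EuclideanSpace ℝ (Fin 3)),
          0 < L ∧ 0 < V ∧ IsColumnar W ∧ (∀ x, ‖u t x‖ ≤ V) ∧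
          (∃ x₁, dist x₁ x₀ ≤ L ∧ V ≤ 2 * ‖u t x₁‖) ∧
          (∃ y y' : EuclideanSpace ℝ (Fin 3), ‖y‖ ≤ 1 ∧ ‖y'‖ ≤ 1 ∧ (4 : ℝ)⁻¹ ≤ ‖W y - W y'‖) ∧
          5 * (1 : ℝ) ≤ L * V ∧
          (∀ y : EuclideanSpace ℝ (Fin 3), ‖y‖ ≤ 5 →
            ‖V⁻¹ • Q.symm (u t (x₀ + L • Q y)) - W y‖ ≤ (5 : ℝ)⁻¹) ∧
          (1 - t) * V ≤ 5 * L) := by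
  -- the profile and the family
  set G : EuclideanSpace ℝ (Fin 3) → EuclideanSpace ℝ (Fin 3) :=
    fun y => max 0 (1 - cylRadius y) • (eZ : EuclideanSpace ℝ (Fin 3)) with hG
  set u : ℝ → EuclideanSpace ℝ (Fin 3) → EuclideanSpace ℝ (Fin 3) :=
    fun t x => if ‖x‖ ≤ (1 - t) / 3 then ((1 - t)⁻¹ ^ 3) • G (((1 - t) ^ 4)⁻¹ • x) else 0 with hu
  have hGle : ∀ y, ‖G y‖ ≤ 1 := fun y => norm_coneProfile_le y
  have hG0 : G 0 = eZ := coneProfile_zero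
  have hGcol : IsColumnar G := isColumnar_coneProfile
  -- value at the origin and the global speed bound
  have hu0 : ∀ t < (1 : ℝ), u t 0 = ((1 - t)⁻¹ ^ 3) • (eZ : EuclideanSpace ℝ (Fin 3)) := by
    intro t ht
    have h : ‖(0 : EuclideanSpace ℝ (Fin 3))‖ ≤ (1 - t) / 3 := by rw [norm_zero]; linarith
    simp only [hu, if_pos h, smul_zero, hG0]
  have hnorm0 : ∀ t < (1 : ℝ), ‖u t 0‖ = (1 - t)⁻¹ ^ 3 := by
    intro t ht
    rw [hu0 t ht, norm_smul, norm_eZ, mul_one, Real.norm_of_nonneg (by positivity)]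
  have hbound : ∀ t < (1 : ℝ), ∀ x, ‖u t x‖ ≤ (1 - t)⁻¹ ^ 3 := by
    intro t ht x
    by_cases hx : ‖x‖ ≤ (1 - t) / 3
    · simp only [hu, if_pos hx]
      rw [norm_smul, Real.norm_of_nonneg (by positivity)]
      exact mul_le_of_le_one_right (by positivity) (hGle _)
    · simp only [hu, if_neg hx, norm_zero]
      positivity
  have hsupp : ∀ t x, u t x ≠ 0 → dist x (0 : EuclideanSpace ℝ (Fin 3)) ≤ (1 - t) / 3 := by
    intro t x hx
    rw [dist_zero_right]
    by_contra h
    exact hx (by simp only [hu, if_neg h])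
  -- the field vanishes entirely at and after the blow-up time
  have hzero : ∀ t : ℝ, 1 ≤ t → ∀ x, u t x = 0 := by
    intro t ht x
    by_cases hx : ‖x‖ ≤ (1 - t) / 3
    · have hx0 : ‖x‖ = 0 := le_antisymm (hx.trans (by linarith)) (norm_nonneg _)
      have ht1 : 1 - t = 0 := by linarith [norm_nonneg x, hx]
      simp only [hu, if_pos hx, ht1, inv_zero, ne_eq, OfNat.ofNat_ne_zero, not_false_eq_true,
        zero_pow, zero_smul]
    · simp only [hu, if_neg hx]
  -- on the tube the horizontal coordinates are at most `s⁴`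
  have htube : ∀ t < (1 : ℝ), ∀ x, u t x ≠ 0 →
      |x 0| ≤ (1 - t) ^ 4 ∧ |x 1| ≤ (1 - t) ^ 4 ∧ |x 2| ≤ (1 - t) / 3 := by
    intro t ht x hx
    have hs : 0 < 1 - t := sub_pos.2 ht
    have hxn : ‖x‖ ≤ (1 - t) / 3 := by
      by_contra h
      exact hx (by simp only [hu, if_neg h])
    have hGx : G (((1 - t) ^ 4)⁻¹ • x) ≠ 0 := by
      intro h0
      exact hx (by simp only [hu, if_pos hxn, h0, smul_zero])
    have hr : cylRadius (((1 - t) ^ 4)⁻¹ • x) < 1 := by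
      by_contra h
      push Not at h
      exact hGx (by rw [hG]; simp only [max_eq_left (by linarith : 1 - cylRadius _ ≤ (0:ℝ)), zero_smul])
    rw [cylRadius_smul, abs_of_pos (by positivity)] at hr
    have hr' : cylRadius x < (1 - t) ^ 4 := by
      have h4 : 0 < (1 - t) ^ 4 := by positivity
      have := mul_lt_mul_of_pos_left hr h4
      rwa [← mul_assoc, mul_inv_cancel₀ h4.ne', one_mul, mul_one] at this
    -- coordinate bounds `|x₀|, |x₁| ≤ r(x)` and `|x₂| ≤ ‖x‖`
    have hc0 : |x 0| ≤ cylRadius x := by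
      rw [cylRadius, ← Real.sqrt_sq_eq_abs]
      exact Real.sqrt_le_sqrt (by nlinarith [sq_nonneg (x 1)])
    have hc1 : |x 1| ≤ cylRadius x := by
      rw [cylRadius, ← Real.sqrt_sq_eq_abs]
      exact Real.sqrt_le_sqrt (by nlinarith [sq_nonneg (x 0)])
    have hc2 : |x 2| ≤ ‖x‖ := by simpa using PiLp.norm_apply_le x 2
    exact ⟨hc0.trans hr'.le, hc1.trans hr'.le, hc2.trans hxn⟩
  -- the energy bound at times `t < 1`
  have henergy : ∀ t < (1 : ℝ), ∫⁻ x, ‖u t x‖ₑ ^ 2 ≤ ENNReal.ofReal (8 / 3 * (1 - t) ^ 3) := by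
    intro t ht
    have hs : 0 < 1 - t := sub_pos.2 ht
    set c : Fin 3 → ℝ := ![(1 - t) ^ 4, (1 - t) ^ 4, (1 - t) / 3] with hc
    set S : Set (EuclideanSpace ℝ (Fin 3)) :=
      (WithLp.ofLp : EuclideanSpace ℝ (Fin 3) → (Fin 3 → ℝ)) ⁻¹' Icc (-c) c with hS
    have hpt : ∀ x, ‖u t x‖ₑ ^ 2 ≤ S.indicator (fun _ => ENNReal.ofReal ((1 - t)⁻¹ ^ 3) ^ 2) x := by
      intro x
      by_cases hx : u t x = 0
      · simp [hx]
      · obtain ⟨h0, h1, h2⟩ := htube t ht x hx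
        have hxS : x ∈ S := by
          rw [hS, mem_preimage, mem_Icc]
          refine ⟨fun i => ?_, fun i => ?_⟩ <;> fin_cases i <;>
            simp [hc, abs_le.1 h0, abs_le.1 h1, abs_le.1 h2]
        rw [indicator_of_mem hxS]
        have h := hbound t ht x
        have h' : ‖u t x‖ₑ ≤ ENNReal.ofReal ((1 - t)⁻¹ ^ 3) := by
          rw [← ofReal_norm]
          exact ENNReal.ofReal_le_ofReal h
        exact pow_le_pow_left' h' 2
    calc ∫⁻ x, ‖u t x‖ₑ ^ 2
        ≤ ∫⁻ x, S.indicator (fun _ => ENNReal.ofReal ((1 - t)⁻¹ ^ 3) ^ 2) x := lintegral_mono hpt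
      _ ≤ ENNReal.ofReal ((1 - t)⁻¹ ^ 3) ^ 2 * volume S := lintegral_indicator_const_le _ _
      _ = ENNReal.ofReal ((1 - t)⁻¹ ^ 3) ^ 2 * (ENNReal.ofReal ((1 - t) ^ 4 + (1 - t) ^ 4) *
            ENNReal.ofReal ((1 - t) ^ 4 + (1 - t) ^ 4) *
            ENNReal.ofReal ((1 - t) / 3 + (1 - t) / 3)) := by
          rw [hS, volume_coordBox]
          simp [hc]
      _ = ENNReal.ofReal (8 / 3 * (1 - t) ^ 3) := by
          rw [← ENNReal.ofReal_pow (by positivity), ← ENNReal.ofReal_mul (by positivity),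
            ← ENNReal.ofReal_mul (by positivity), ← ENNReal.ofReal_mul (by positivity)]
          congr 1
          field_simp
          ring
  -- exact columnarity on the ball `‖x‖ ≤ (1-t)/3`
  have hcore : ∀ t < (1 : ℝ), ∀ (L : ℝ) (y : EuclideanSpace ℝ (Fin 3)), 0 ≤ L → L * ‖y‖ ≤ (1 - t) / 3 →
      u t ((0 : EuclideanSpace ℝ (Fin 3)) + L • (LinearIsometryEquiv.refl ℝ _ y)) =
        ((1 - t)⁻¹ ^ 3) • G ((((1 - t) ^ 4)⁻¹ * L) • y) := by
    intro t ht L y hL hy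
    have hn : ‖L • y‖ ≤ (1 - t) / 3 := by
      rw [norm_smul, Real.norm_of_nonneg hL]; exact hy
    simp only [LinearIsometryEquiv.coe_refl, id_eq, zero_add]
    simp only [hu, if_pos hn, smul_smul]
  refine ⟨u, ?_, ?_, ?_, henergy, fun t x hx => by simpa [dist_zero_right] using hsupp t x hx, ?_, ?_⟩
  · -- (i) witnesses at every level frequently before `1`
    intro K hK t₀ ht₀
    set m : ℝ := min K (4 * K)⁻¹ with hm
    have hm0 : 0 < m := lt_min hK (by positivity)
    set t : ℝ := (max t₀ (1 - m) + 1) / 2 with ht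
    have hmax_lt : max t₀ (1 - m) < 1 := max_lt ht₀ (by linarith)
    have ht₀t : t₀ < t := by
      have := le_max_left t₀ (1 - m); rw [ht]; linarith
    have ht1 : t < 1 := by rw [ht]; linarith
    have hs : 0 < 1 - t := sub_pos.2 ht1
    have hsm : 1 - t ≤ m := by
      have := le_max_right t₀ (1 - m); rw [ht]; linarith
    have hsK : 1 - t ≤ K := hsm.trans (min_le_left _ _)
    have hsK' : (1 - t) * K ≤ 4⁻¹ := by
      calc (1 - t) * K ≤ (4 * K)⁻¹ * K := mul_le_mul_of_nonneg_right (hsm.trans (min_le_right _ _)) hK.le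
        _ = 4⁻¹ := by field_simp
    -- the witness: centre `0`, `L = K s³`, `V = s⁻³`, frame `id`, profile `G ((K/s) •)`
    refine ⟨t, ht₀t, ht1, 0, K * (1 - t) ^ 3, (1 - t)⁻¹ ^ 3, LinearIsometryEquiv.refl ℝ _,
      fun y => G ((K * (1 - t)⁻¹) • y), by positivity, by positivity, ?_, hbound t ht1, ?_, ?_, ?_, ?_⟩
    · -- columnar (dilate of a columnar profile)
      simpa using hGcol.rescale 0 (K * (1 - t)⁻¹)
    · refine ⟨0, by rw [dist_self]; positivity, ?_⟩
      rw [hnorm0 t ht1]; linarith [pow_pos (inv_pos.2 hs) 3]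
    · refine ⟨0, EuclideanSpace.single 0 1, by simp, by simp, ?_⟩
      have hc : (1 : ℝ) ≤ K * (1 - t)⁻¹ := by
        rw [← div_eq_mul_inv, le_div_iff₀ hs, one_mul]; exact hsK
      have hG1 : G ((K * (1 - t)⁻¹) • EuclideanSpace.single 0 1) = 0 := coneProfile_smul_single_zero hc
      simp only [smul_zero]
      rw [hG0, hG1, sub_zero, norm_eZ]
      norm_num
    · -- Reynolds: `K · 1 ≤ (K s³) · s⁻³ = K`
      have h1 : K * (1 - t) ^ 3 * (1 - t)⁻¹ ^ 3 = K := by field_simp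
      rw [mul_one, h1]
    · intro y hy
      have hy' : K * (1 - t) ^ 3 * ‖y‖ ≤ (1 - t) / 3 := by
        have h1 : K * (1 - t) ^ 3 * ‖y‖ ≤ K * (1 - t) ^ 3 * K :=
          mul_le_mul_of_nonneg_left hy (by positivity)
        have h2 : K * (1 - t) ^ 3 * K = ((1 - t) * K) ^ 2 * (1 - t) := by ring
        have h3 : ((1 - t) * K) ^ 2 ≤ (4⁻¹ : ℝ) ^ 2 :=
          pow_le_pow_left₀ (by positivity) hsK' 2
        nlinarith
      have hrefl : ∀ z : EuclideanSpace ℝ (Fin 3),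
          (LinearIsometryEquiv.refl ℝ (EuclideanSpace ℝ (Fin 3))).symm z = z := fun z => rfl
      have hscal : ((1 - t) ^ 4)⁻¹ * (K * (1 - t) ^ 3) = K * (1 - t)⁻¹ := by field_simp
      rw [hcore t ht1 (K * (1 - t) ^ 3) y (by positivity) hy', hrefl, smul_smul,
        inv_mul_cancel₀ (by positivity : (1 - t)⁻¹ ^ 3 ≠ 0), one_smul, hscal, sub_self, norm_zero]
      positivity
  · -- (ii) faster than the Type-I rate at the origin
    rintro ⟨C, hC⟩
    obtain ⟨l, hl1, hsub⟩ := mem_nhdsLT_iff_exists_Ioo_subset.1 hC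
    rw [mem_Iio] at hl1
    set s : ℝ := min ((1 - l) / 2) (|C| + 2)⁻¹ with hsdef
    have hC2 : 0 < |C| + 2 := by positivity
    have hs0 : 0 < s := lt_min (by linarith) (inv_pos.2 hC2)
    have hsl : s ≤ (1 - l) / 2 := min_le_left _ _
    have hsC : s ≤ (|C| + 2)⁻¹ := min_le_right _ _
    have hs1 : s ≤ 1 := hsC.trans (inv_le_one_of_one_le₀ (by linarith [abs_nonneg C]))
    have hmem : 1 - s ∈ Ioo l 1 := ⟨by linarith, by linarith⟩
    have h : ‖u (1 - s) 0‖ ≤ C / Real.sqrt (1 - (1 - s)) := hsub hmem 0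
    rw [hnorm0 (1 - s) (by linarith)] at h
    simp only [sub_sub_cancel] at h
    have hsqrt : 0 < Real.sqrt s := Real.sqrt_pos.2 hs0
    have hsqrt_ge : s ≤ Real.sqrt s := by
      rw [Real.le_sqrt hs0.le hs0.le]
      nlinarith
    have h2 : s⁻¹ ^ 3 * Real.sqrt s ≤ C := by
      have := mul_le_mul_of_nonneg_right h hsqrt.le
      rwa [div_mul_cancel₀ _ hsqrt.ne'] at this
    have h3 : s⁻¹ ^ 2 ≤ C := by
      calc s⁻¹ ^ 2 = s⁻¹ ^ 3 * s := by field_simp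
        _ ≤ s⁻¹ ^ 3 * Real.sqrt s := mul_le_mul_of_nonneg_left hsqrt_ge (by positivity)
        _ ≤ C := h2
    have h4 : |C| + 2 ≤ s⁻¹ := by
      rw [le_inv_comm₀ hC2 hs0]
      exact hsC
    have h5 : (|C| + 2) ^ 2 ≤ s⁻¹ ^ 2 := pow_le_pow_left₀ hC2.le h4 2
    nlinarith [le_abs_self C, abs_nonneg C]
  · -- (iii) bounded energy: `8/3` works for all `t ≥ 0`
    refine ⟨ENNReal.ofReal (8 / 3), ENNReal.ofReal_lt_top, fun t ht => ?_⟩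
    by_cases ht1 : t < 1
    · refine (henergy t ht1).trans (ENNReal.ofReal_le_ofReal ?_)
      have h1 : (1 - t) ^ 3 ≤ 1 := pow_le_one₀ (by linarith) (by linarith)
      linarith
    · push Not at ht1
      simp [hzero t ht1]
  · -- (vi) every level-`K` datum (`K > 4`) has small core radius and is not late
    intro K t hK ht0 ht1 x₀ L V Q W hL hV hW hbd hnear hclose
    have hs : 0 < 1 - t := sub_pos.2 ht1
    have hs1 : 1 - t < 1 := by linarith
    have hKL : K * L < 3 * ((1 - t) / 3) :=
      coreRadius_lt_of_support (hsupp t) hK hL hV hW hnear hclose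
    have hV' : (1 - t)⁻¹ ^ 3 ≤ V := by rw [← hnorm0 t ht1]; exact hbd 0
    refine ⟨by linarith, ?_⟩
    have h1 : (1 : ℝ) ≤ (1 - t)⁻¹ ^ 3 := one_le_pow₀ (one_le_inv_iff₀.2 ⟨hs, hs1.le⟩)
    have h2 : (1 - t) * 1 ≤ (1 - t) * V := mul_le_mul_of_nonneg_left (h1.trans hV') hs.le
    linarith
  · -- (vii) no late level-`5` witness at any time in `(0,1)`
    rintro ⟨t, ht0, ht1, x₀, L, V, Q, W, hL, hV, hW, hbd, hnear, -, -, hclose, hl⟩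
    have hs : 0 < 1 - t := sub_pos.2 ht1
    have hKL : 5 * L < 3 * ((1 - t) / 3) :=
      coreRadius_lt_of_support (hsupp t) (by norm_num) hL hV hW hnear hclose
    have hV' : (1 - t)⁻¹ ^ 3 ≤ V := by rw [← hnorm0 t ht1]; exact hbd 0
    have h1 : (1 : ℝ) ≤ (1 - t)⁻¹ ^ 3 := one_le_pow₀ (one_le_inv_iff₀.2 ⟨hs, by linarith⟩)
    have h2 : (1 - t) * 1 ≤ (1 - t) * V := mul_le_mul_of_nonneg_left (h1.trans hV') hs.le
    linarith

/-! ### §3 Corollary: a witness at any level is compatible with arbitrarily small energy -/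

/-- **No energy lower bound follows from a core witness.**  For every level `K > 0` and every `ε > 0` there are a
field `u : ℝ → ℝ³ → ℝ³` and a time `t` such that the slice `u t` carries a level-`K` COLUMNAR core witness at
viscosity `1` (`TypeIICoreWitness IsColumnar 1 K u t`: speed bound `V` attained within a factor `2` in the core
ball, oscillation `≥ 1/4`, core Reynolds number `L V ≥ K`, exact `C⁰`-closeness on `K` core radii) while its kinetic
energy is at most `ε`: `∫ ‖u(t,x)‖² dx ≤ ε`.  (The thin-tube family of
`exists_columnarWitnesses_never_late_boundedEnergy` at a time `t` with `(8/3)(1-t)³ ≤ ε`.)  The witness clauses do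
not bound the thickness of the core, so the Leray–Hopf energy bound cannot interact with the witness hypothesis
`hw` of crux `ColumnarCoreExclusion` at the kinematic level. [folklore] -/
theorem exists_columnarWitness_energy_le (K ε : ℝ) (hK : 0 < K) (hε : 0 < ε) :
    ∃ (u : ℝ → EuclideanSpace ℝ (Fin 3) → EuclideanSpace ℝ (Fin 3)) (t : ℝ),
      TypeIICoreWitness IsColumnar 1 K u t ∧ ∫⁻ x, ‖u t x‖ₑ ^ 2 ≤ ENNReal.ofReal ε := by
  obtain ⟨u, hw, -, -, hen, -⟩ := exists_columnarWitnesses_never_late_boundedEnergy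
  -- a time after which `(8/3)(1-t)³ ≤ ε`
  set δ : ℝ := min 1 (3 / 8 * ε) with hδ
  have hδ0 : 0 < δ := lt_min one_pos (by positivity)
  have hδ1 : δ ≤ 1 := min_le_left _ _
  have hδε : δ ≤ 3 / 8 * ε := min_le_right _ _
  obtain ⟨t, ht0, ht1, hwit⟩ := hw K hK (1 - δ) (by linarith)
  refine ⟨u, t, hwit, (hen t ht1).trans (ENNReal.ofReal_le_ofReal ?_)⟩
  have hs0 : 0 < 1 - t := sub_pos.2 ht1
  have hsδ : 1 - t ≤ δ := by linarith
  have h3 : (1 - t) ^ 3 ≤ (1 - t) := by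
    have := pow_le_pow_of_le_one hs0.le (hsδ.trans hδ1) (by norm_num : 1 ≤ 3)
    simpa using this
  nlinarith

end CoreExclusionAnchorObstructionEnergy

end Summit.NavierStokesRegularity.NavierStokesRegularity.Theorems

end
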